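import Summits.PneNP.PneNP.Theorems.SmallBlockRothvossAngularCells
import HarnessLib

/-!
# Cell pnp-psdrank, T-SOC (`SmallBlockRothvoss`): the `ε`-net sandwich for rank-one-vector terms in `ℝ²`

ROUND-4 §6 steps (3)–(4) of planner p2 (HOME/pnp-psdrank-p2/Sketch-R4-smallblock.lean, `NetSandwich2`):
`cell_pair_bound` (one pair of angular cells: good pairs by the sandwich and the layer cake
`Literature.Barriers.PneNP.sum_mul_mul_le_of_rectangles`, garbage pairs pointwise), the main estimate
`netSandwich2_main` with the explicit constant `289 π²` — for `a x, b y ∈ ℝ²` with `|a x|² ≤ A₀`, `|b y|² ≤ B₀`,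
`a x ⊥ b y` on tight pairs, `kA, kB ≥ 0` and every tight-free rectangle sum of `kA − kB` at most `θ₀`:
`Σ (kA − kB)⟪a,b⟫² ≤ 289π²(A₀B₀)²θ₀/(η²τ) + η Σ kA⟪a,b⟫² + τ Σ kA` (`0 < η ≤ 1`, `τ > 0`) — and its
all-rectangle form `netSandwich2_dominated` (weights `W ≤ K`, `K ≥ 0`, as produced by Rothvoß's weight datum).
p2's closed Prop `NetSandwich2` is exactly `∃ C > 0, <netSandwich2_main with C for 289π²>`; it is not restated
here (no route item yet) — `netSandwich2_main` is its explicit witness.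
Source: pnp-psdrank-eng g3's farm-checked cumulative work file `HOME/pnp-psdrank-eng/lean/SocLift.lean`
(Part A, sha16 68f549726b9fc648; rc 0, 0 sorries, axioms standard), split per landing/README.md.
WHAT THIS IS NOT: a psd-rank statement — it is the analytic inequality feeding the `2 × 2`-block accounting.
-/

set_option linter.dupNamespace false -- `Summit.PneNP.PneNP.…`: summit = sub-problem (D-0017)

noncomputable section

open Finset Real

namespace Summit.PneNP.PneNP.Theorems.SmallBlockRothvoss

/-! ### One cell pair -/

section Main

variable {α β : Type} [Fintype α] [Fintype β]

/-- **The estimate on one cell pair** `X × Y` (all row angles within `w/2` of the centre of cell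
`i`, all column angles within `w/2` of the centre of cell `j`): good pairs by the sandwich and the
layer cake, garbage pairs pointwise. -/
theorem cell_pair_bound (kA kB : α → β → ℝ) (tight : α → β → Prop) (θ₀ A₀ B₀ η τ : ℝ)
    (a : α → Fin 2 → ℝ) (b : β → Fin 2 → ℝ)
    (hkA : ∀ x y, 0 ≤ kA x y) (hkB : ∀ x y, 0 ≤ kB x y) (hθ : 0 ≤ θ₀) (hη : 0 < η) (hη1 : η ≤ 1)
    (hτ : 0 < τ) (hA : 0 < A₀) (hB : 0 < B₀)
    (ha : ∀ x, dotProduct (a x) (a x) ≤ A₀) (hb : ∀ y, dotProduct (b y) (b y) ≤ B₀)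
    (htight : ∀ x y, tight x y → dotProduct (a x) (b y) = 0)
    (hrect : ∀ (X : Finset α) (Y : Finset β), (∀ x ∈ X, ∀ y ∈ Y, ¬ tight x y) →
        ∑ x ∈ X, ∑ y ∈ Y, (kA x y - kB x y) ≤ θ₀)
    {J : ℕ} (hJ : 0 < J) (hF1 : (A₀ * B₀) * (8 * width J / η) ^ 2 ≤ τ) (i j : ℕ)
    (X : Finset α) (Y : Finset β)
    (hX : ∀ x ∈ X, |ang (a x) - center J i| ≤ width J / 2)
    (hY : ∀ y ∈ Y, |ang (b y) - center J j| ≤ width J / 2) :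
    ∑ x ∈ X, ∑ y ∈ Y, (kA x y - kB x y) * (dotProduct (a x) (b y)) ^ 2 ≤
      (A₀ * B₀) * θ₀ + η * ∑ x ∈ X, ∑ y ∈ Y, kA x y * (dotProduct (a x) (b y)) ^ 2
        + τ * ∑ x ∈ X, ∑ y ∈ Y, kA x y := by
  classical
  -- shorthand
  set ρ : α → ℝ := fun x => dotProduct (a x) (a x) with hρ
  set σ : β → ℝ := fun y => dotProduct (b y) (b y) with hσ
  set G : α → β → ℝ := fun x y => (dotProduct (a x) (b y)) ^ 2 with hGdef
  set Λ : ℝ := A₀ * B₀ with hΛ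
  set w : ℝ := width J with hwdef
  have hw : 0 < w := width_pos hJ
  have hΛ0 : 0 < Λ := mul_pos hA hB
  have hρ0 : ∀ x, 0 ≤ ρ x := fun x => dotProduct_self_nonneg' (a x)
  have hσ0 : ∀ y, 0 ≤ σ y := fun y => dotProduct_self_nonneg' (b y)
  have hG0 : ∀ x y, 0 ≤ G x y := fun x y => sq_nonneg _
  have hGpolar : ∀ x y, G x y = ρ x * σ y * Real.cos (ang (a x) - ang (b y)) ^ 2 :=
    fun x y => dotProduct_sq_eq_polar (a x) (b y)
  have hρσΛ : ∀ x y, ρ x * σ y ≤ Λ := fun x y => mul_le_mul (ha x) (hb y) (hσ0 y) hA.le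
  have hPX0 : 0 ≤ ∑ x ∈ X, ∑ y ∈ Y, kA x y * G x y :=
    sum_nonneg fun x _ => sum_nonneg fun y _ => mul_nonneg (hkA x y) (hG0 x y)
  have hQX0 : 0 ≤ ∑ x ∈ X, ∑ y ∈ Y, kA x y := sum_nonneg fun x _ => sum_nonneg fun y _ => hkA x y
  have hΛθ : 0 ≤ Λ * θ₀ := by positivity
  -- deviation from the centre value
  set κ : ℝ := |Real.cos (((i : ℝ) - (j : ℝ)) * w)| with hκ
  have hκ1 : κ ≤ 1 := Real.abs_cos_le_one _
  have hdev : ∀ x ∈ X, ∀ y ∈ Y, |(|Real.cos (ang (a x) - ang (b y))|) - κ| ≤ w :=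
    fun x hx y hy => abs_abs_cos_sub_le (hX x hx) (hY y hy)
  by_cases hgood : (6 / η + 1) * w ≤ κ
  · -- good cell pair: sandwich + layer cake
    set clo : ℝ := (κ - w) ^ 2 with hclo
    set chi : ℝ := (κ + w) ^ 2 with hchi
    have hκw : 6 * w / η ≤ κ - w := by
      have : (6 / η + 1) * w = 6 * w / η + w := by ring
      linarith
    have hκw0 : 0 < κ - w := lt_of_lt_of_le (by positivity) hκw
    have hclo0 : 0 < clo := by positivity
    have hclo1 : clo ≤ 1 := by
      rw [hclo]
      have : κ - w ≤ 1 := by linarith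
      nlinarith
    have hratio : chi ≤ (1 + η) * clo := good_ratio hη hη1 hw.le hgood
    have hsand : ∀ x ∈ X, ∀ y ∈ Y,
        clo * (ρ x * σ y) ≤ G x y ∧ G x y ≤ chi * (ρ x * σ y) := by
      intro x hx y hy
      have hd := abs_le.1 (hdev x hx y hy)
      have hlo : κ - w ≤ |Real.cos (ang (a x) - ang (b y))| := by linarith
      have hhi : |Real.cos (ang (a x) - ang (b y))| ≤ κ + w := by linarith
      have hlo2 : clo ≤ Real.cos (ang (a x) - ang (b y)) ^ 2 := by
        rw [hclo, ← sq_abs (Real.cos _)]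
        exact pow_le_pow_left₀ hκw0.le hlo 2
      have hhi2 : Real.cos (ang (a x) - ang (b y)) ^ 2 ≤ chi := by
        rw [hchi, ← sq_abs (Real.cos _)]
        exact pow_le_pow_left₀ (abs_nonneg _) hhi 2
      have hPxy : 0 ≤ ρ x * σ y := mul_nonneg (hρ0 x) (hσ0 y)
      rw [hGpolar]
      constructor
      · calc clo * (ρ x * σ y) = ρ x * σ y * clo := mul_comm _ _
          _ ≤ ρ x * σ y * Real.cos (ang (a x) - ang (b y)) ^ 2 :=
              mul_le_mul_of_nonneg_left hlo2 hPxy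
      · calc ρ x * σ y * Real.cos (ang (a x) - ang (b y)) ^ 2 ≤ ρ x * σ y * chi :=
              mul_le_mul_of_nonneg_left hhi2 hPxy
          _ = chi * (ρ x * σ y) := mul_comm _ _
    -- pointwise sandwich, summed
    have hsum1 : ∑ x ∈ X, ∑ y ∈ Y, (kA x y - kB x y) * G x y ≤
        clo * ∑ x ∈ X, ∑ y ∈ Y, (kA x y - kB x y) * (ρ x * σ y)
          + η * ∑ x ∈ X, ∑ y ∈ Y, kA x y * G x y := by
      rw [mul_sum, mul_sum, ← sum_add_distrib]
      refine sum_le_sum fun x hx => ?_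
      rw [mul_sum, mul_sum, ← sum_add_distrib]
      refine sum_le_sum fun y hy => ?_
      obtain ⟨hlo, hhi⟩ := hsand x hx y hy
      exact pointwise_sandwich (hkA x y) (hkB x y) (mul_nonneg (hρ0 x) (hσ0 y)) hη.le hratio hlo hhi
    -- layer cake on the (tight-free) rectangle `X × Y`
    have hcake : ∑ x ∈ X, ∑ y ∈ Y, (kA x y - kB x y) * (ρ x * σ y) ≤ Λ * θ₀ := by
      set xv : α → ℝ := fun x => if x ∈ X then ρ x / A₀ else 0 with hxv
      set yv : β → ℝ := fun y => if y ∈ Y then σ y / B₀ else 0 with hyv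
      have hx01 : ∀ x, 0 ≤ xv x ∧ xv x ≤ 1 := by
        intro x
        simp only [hxv]
        split_ifs
        · exact ⟨div_nonneg (hρ0 x) hA.le, (div_le_one hA).2 (ha x)⟩
        · exact ⟨le_rfl, zero_le_one⟩
      have hy01 : ∀ y, 0 ≤ yv y ∧ yv y ≤ 1 := by
        intro y
        simp only [hyv]
        split_ifs
        · exact ⟨div_nonneg (hσ0 y) hB.le, (div_le_one hB).2 (hb y)⟩
        · exact ⟨le_rfl, zero_le_one⟩
      have hrect' : ∀ (X' : Finset α) (Y' : Finset β), (∀ x ∈ X', 0 < xv x) →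
          (∀ y ∈ Y', 0 < yv y) → ∑ x ∈ X', ∑ y ∈ Y', (kA x y - kB x y) ≤ θ₀ := by
        intro X' Y' hX' hY'
        apply hrect X' Y'
        intro x hx y hy htxy
        have hx1 := hX' x hx
        have hy1 := hY' y hy
        simp only [hxv, hyv] at hx1 hy1
        split_ifs at hx1 with hxX
        · split_ifs at hy1 with hyY
          · have hρx : 0 < ρ x := (div_pos_iff_of_pos_right hA).1 hx1
            have hσy : 0 < σ y := (div_pos_iff_of_pos_right hB).1 hy1
            have hGpos : 0 < G x y :=
              lt_of_lt_of_le (mul_pos hclo0 (mul_pos hρx hσy)) (hsand x hxX y hyY).1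
            have h0 : dotProduct (a x) (b y) = 0 := htight x y htxy
            have : G x y = 0 := by rw [hGdef]; dsimp only; rw [h0]; ring
            linarith
          · exact absurd hy1 (lt_irrefl 0)
        · exact absurd hx1 (lt_irrefl 0)
      have key := Literature.Barriers.PneNP.sum_mul_mul_le_of_rectangles
        (fun x y => kA x y - kB x y) θ₀ xv yv hx01 hy01 hrect'
      -- unfold the fractional rectangle
      have hrow : ∀ x, (∑ y, (kA x y - kB x y) * (xv x * yv y)) * (A₀ * B₀) =
          if x ∈ X then ∑ y ∈ Y, (kA x y - kB x y) * (ρ x * σ y) else 0 := by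
        intro x
        simp only [hxv]
        split_ifs with hxX
        · rw [sum_mul, ← sum_ite_mem_univ Y]
          refine sum_congr rfl fun y _ => ?_
          simp only [hyv]
          split_ifs with hyY
          · field_simp
          · simp
        · simp
      have hexp : (∑ x, ∑ y, (kA x y - kB x y) * (xv x * yv y)) * (A₀ * B₀) =
          ∑ x ∈ X, ∑ y ∈ Y, (kA x y - kB x y) * (ρ x * σ y) := by
        rw [sum_mul, sum_congr rfl fun x _ => hrow x, sum_ite_mem_univ]
      rw [← hexp, hΛ, mul_comm (A₀ * B₀) θ₀]
      exact mul_le_mul_of_nonneg_right key (mul_pos hA hB).le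
    have hclocake : clo * ∑ x ∈ X, ∑ y ∈ Y, (kA x y - kB x y) * (ρ x * σ y) ≤ Λ * θ₀ := by
      by_cases hZ : 0 ≤ ∑ x ∈ X, ∑ y ∈ Y, (kA x y - kB x y) * (ρ x * σ y)
      · calc clo * ∑ x ∈ X, ∑ y ∈ Y, (kA x y - kB x y) * (ρ x * σ y)
            ≤ 1 * ∑ x ∈ X, ∑ y ∈ Y, (kA x y - kB x y) * (ρ x * σ y) :=
              mul_le_mul_of_nonneg_right hclo1 hZ
          _ ≤ Λ * θ₀ := by rw [one_mul]; exact hcake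
      · push Not at hZ
        have : clo * ∑ x ∈ X, ∑ y ∈ Y, (kA x y - kB x y) * (ρ x * σ y) ≤ 0 :=
          mul_nonpos_of_nonneg_of_nonpos hclo0.le hZ.le
        linarith
    linarith [mul_nonneg hτ.le hQX0]
  · -- garbage cell pair
    push Not at hgood
    have hGτ : ∀ x ∈ X, ∀ y ∈ Y, G x y ≤ τ := by
      intro x hx y hy
      have hd := abs_le.1 (hdev x hx y hy)
      have hcos : |Real.cos (ang (a x) - ang (b y))| ≤ 8 * w / η := by
        have h1 : |Real.cos (ang (a x) - ang (b y))| ≤ κ + w := by linarith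
        have h2 : κ + w ≤ (6 / η + 2) * w := by linarith
        have h3 : (6 / η + 2) * w ≤ 8 * w / η := by
          rw [le_div_iff₀ hη]
          have : (6 / η + 2) * w * η = 6 * w + 2 * w * η := by field_simp
          rw [this]
          nlinarith
        linarith
      have hcos2 : Real.cos (ang (a x) - ang (b y)) ^ 2 ≤ (8 * w / η) ^ 2 := by
        rw [← sq_abs (Real.cos _)]
        exact pow_le_pow_left₀ (abs_nonneg _) hcos 2
      rw [hGpolar]
      calc ρ x * σ y * Real.cos (ang (a x) - ang (b y)) ^ 2 ≤ Λ * (8 * w / η) ^ 2 :=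
            mul_le_mul (hρσΛ x y) hcos2 (sq_nonneg _) hΛ0.le
        _ ≤ τ := hF1
    have hgarb : ∑ x ∈ X, ∑ y ∈ Y, (kA x y - kB x y) * G x y ≤ τ * ∑ x ∈ X, ∑ y ∈ Y, kA x y := by
      rw [mul_sum]
      refine sum_le_sum fun x hx => ?_
      rw [mul_sum]
      refine sum_le_sum fun y hy => ?_
      have h1 : kA x y * G x y ≤ kA x y * τ := mul_le_mul_of_nonneg_left (hGτ x hx y hy) (hkA x y)
      have h2 : 0 ≤ kB x y * G x y := mul_nonneg (hkB x y) (hG0 x y)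
      nlinarith
    linarith [mul_nonneg hη.le hPX0]

/-! ### The main estimate -/

/-- **The `ε`-net sandwich (ROUND-4 §6 (3)–(4)), explicit constant `289 π²`.** -/
theorem netSandwich2_main (kA kB : α → β → ℝ) (tight : α → β → Prop) (θ₀ A₀ B₀ η τ : ℝ)
    (a : α → Fin 2 → ℝ) (b : β → Fin 2 → ℝ)
    (hkA : ∀ x y, 0 ≤ kA x y) (hkB : ∀ x y, 0 ≤ kB x y) (hθ : 0 ≤ θ₀) (hη : 0 < η) (hη1 : η ≤ 1)
    (hτ : 0 < τ) (hA : 0 < A₀) (hB : 0 < B₀)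
    (ha : ∀ x, dotProduct (a x) (a x) ≤ A₀) (hb : ∀ y, dotProduct (b y) (b y) ≤ B₀)
    (htight : ∀ x y, tight x y → dotProduct (a x) (b y) = 0)
    (hrect : ∀ (X : Finset α) (Y : Finset β), (∀ x ∈ X, ∀ y ∈ Y, ¬ tight x y) →
        ∑ x ∈ X, ∑ y ∈ Y, (kA x y - kB x y) ≤ θ₀) :
    ∑ x, ∑ y, (kA x y - kB x y) * (dotProduct (a x) (b y)) ^ 2 ≤
      (289 * π ^ 2) * (A₀ * B₀) ^ 2 / (η ^ 2 * τ) * θ₀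
        + η * ∑ x, ∑ y, kA x y * (dotProduct (a x) (b y)) ^ 2 + τ * ∑ x, ∑ y, kA x y := by
  classical
  set G : α → β → ℝ := fun x y => (dotProduct (a x) (b y)) ^ 2 with hGdef
  set Λ : ℝ := A₀ * B₀ with hΛ
  have hΛ0 : 0 < Λ := mul_pos hA hB
  have hG0 : ∀ x y, 0 ≤ G x y := fun x y => sq_nonneg _
  have hGΛ : ∀ x y, G x y ≤ Λ := fun x y =>
    (dotProduct_sq_le (a x) (b y)).trans
      (mul_le_mul (ha x) (hb y) (dotProduct_self_nonneg' (b y)) hA.le)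
  have hP0 : 0 ≤ ∑ x, ∑ y, kA x y * G x y :=
    sum_nonneg fun x _ => sum_nonneg fun y _ => mul_nonneg (hkA x y) (hG0 x y)
  have hQ0 : 0 ≤ ∑ x, ∑ y, kA x y := sum_nonneg fun x _ => sum_nonneg fun y _ => hkA x y
  have hC0 : 0 ≤ (289 * π ^ 2) * Λ ^ 2 / (η ^ 2 * τ) * θ₀ := by positivity
  by_cases hΛτ : Λ ≤ τ
  · -- Case 1: every entry is `≤ τ`
    have hgarb : ∀ x y, (kA x y - kB x y) * G x y ≤ τ * kA x y := by
      intro x y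
      have h1 : kA x y * G x y ≤ kA x y * τ :=
        mul_le_mul_of_nonneg_left ((hGΛ x y).trans hΛτ) (hkA x y)
      have h2 : 0 ≤ kB x y * G x y := mul_nonneg (hkB x y) (hG0 x y)
      nlinarith
    calc ∑ x, ∑ y, (kA x y - kB x y) * G x y ≤ ∑ x, ∑ y, τ * kA x y :=
          sum_le_sum fun x _ => sum_le_sum fun y _ => hgarb x y
      _ = τ * ∑ x, ∑ y, kA x y := by simp_rw [mul_sum]
      _ ≤ (289 * π ^ 2) * Λ ^ 2 / (η ^ 2 * τ) * θ₀ + η * ∑ x, ∑ y, kA x y * G x y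
            + τ * ∑ x, ∑ y, kA x y := by nlinarith [mul_nonneg hη.le hP0]
  -- Case 2: `τ < Λ`; the net
  push Not at hΛτ
  obtain ⟨J, hJ, hF1, hF2⟩ := net_constants (θ₀ := θ₀) hη hη1 hτ hΛτ hθ
  -- cells
  let cA : α → Fin J := fun x => ⟨idx J (ang (a x)), idx_lt hJ (ang_mem _)⟩
  let cB : β → Fin J := fun y => ⟨idx J (ang (b y)), idx_lt hJ (ang_mem _)⟩
  have hcA : ∀ x, |ang (a x) - center J (cA x : ℕ)| ≤ width J / 2 := fun x =>
    abs_sub_center_le hJ (ang_mem _)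
  have hcB : ∀ y, |ang (b y) - center J (cB y : ℕ)| ≤ width J / 2 := fun y =>
    abs_sub_center_le hJ (ang_mem _)
  -- per cell-pair bound
  have hcell : ∀ (i j : Fin J),
      ∑ x ∈ univ.filter (fun x => cA x = i), ∑ y ∈ univ.filter (fun y => cB y = j),
          (kA x y - kB x y) * G x y ≤
        Λ * θ₀ + η * ∑ x ∈ univ.filter (fun x => cA x = i), ∑ y ∈ univ.filter (fun y => cB y = j),
          kA x y * G x y
          + τ * ∑ x ∈ univ.filter (fun x => cA x = i), ∑ y ∈ univ.filter (fun y => cB y = j),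
            kA x y := by
    intro i j
    refine cell_pair_bound kA kB tight θ₀ A₀ B₀ η τ a b hkA hkB hθ hη hη1 hτ hA hB ha hb htight
      hrect hJ hF1 (i : ℕ) (j : ℕ) _ _ (fun x hx => ?_) (fun y hy => ?_)
    · have hxi : (cA x : ℕ) = (i : ℕ) := by rw [(mem_filter.1 hx).2]
      rw [← hxi]; exact hcA x
    · have hyj : (cB y : ℕ) = (j : ℕ) := by rw [(mem_filter.1 hy).2]
      rw [← hyj]; exact hcB y
  -- decomposition of the double sums along the cells
  have hdecomp : ∀ F : α → β → ℝ, ∑ x, ∑ y, F x y =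
      ∑ i : Fin J, ∑ j : Fin J, ∑ x ∈ univ.filter (fun x => cA x = i),
        ∑ y ∈ univ.filter (fun y => cB y = j), F x y := by
    intro F
    rw [← Finset.sum_fiberwise univ cA (fun x => ∑ y, F x y)]
    refine sum_congr rfl fun i _ => ?_
    rw [sum_congr rfl fun x _ => (Finset.sum_fiberwise univ cB (F x)).symm, Finset.sum_comm]
  rw [hdecomp (fun x y => (kA x y - kB x y) * G x y), hdecomp (fun x y => kA x y * G x y),
    hdecomp kA]
  calc ∑ i : Fin J, ∑ j : Fin J, ∑ x ∈ univ.filter (fun x => cA x = i),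
          ∑ y ∈ univ.filter (fun y => cB y = j), (kA x y - kB x y) * G x y
      ≤ ∑ i : Fin J, ∑ j : Fin J, (Λ * θ₀
          + η * ∑ x ∈ univ.filter (fun x => cA x = i), ∑ y ∈ univ.filter (fun y => cB y = j),
              kA x y * G x y
          + τ * ∑ x ∈ univ.filter (fun x => cA x = i), ∑ y ∈ univ.filter (fun y => cB y = j),
              kA x y) := sum_le_sum fun i _ => sum_le_sum fun j _ => hcell i j
    _ = ((J : ℝ) ^ 2) * (Λ * θ₀)
          + η * ∑ i : Fin J, ∑ j : Fin J, ∑ x ∈ univ.filter (fun x => cA x = i),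
              ∑ y ∈ univ.filter (fun y => cB y = j), kA x y * G x y
          + τ * ∑ i : Fin J, ∑ j : Fin J, ∑ x ∈ univ.filter (fun x => cA x = i),
              ∑ y ∈ univ.filter (fun y => cB y = j), kA x y := by
        simp only [sum_add_distrib, sum_const, card_univ, Fintype.card_fin, nsmul_eq_mul, ← mul_sum]
        ring
    _ ≤ (289 * π ^ 2) * Λ ^ 2 / (η ^ 2 * τ) * θ₀
          + η * ∑ i : Fin J, ∑ j : Fin J, ∑ x ∈ univ.filter (fun x => cA x = i),
              ∑ y ∈ univ.filter (fun y => cB y = j), kA x y * G x y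
          + τ * ∑ i : Fin J, ∑ j : Fin J, ∑ x ∈ univ.filter (fun x => cA x = i),
              ∑ y ∈ univ.filter (fun y => cB y = j), kA x y := by linarith [hF2]

end Main

/-! ### All-rectangle form (for weight data `W ≤ K`, `K ≥ 0`, as produced by Rothvoß's `Wmat`) -/

section Dominated

variable {α β : Type} [Fintype α] [Fintype β]

/-- **All-rectangle form.** If every rectangle sum of `W` is `≤ θ₀` and `W ≤ K` pointwise with
`K ≥ 0`, then for `a x, b y ∈ ℝ²` with `|a x|² ≤ A₀`, `|b y|² ≤ B₀`:
`Σ W·⟪a,b⟫² ≤ 289π²·(A₀B₀)²θ₀/(η²τ) + η·Σ K·⟪a,b⟫² + τ·Σ K`. -/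
theorem netSandwich2_dominated (W K : α → β → ℝ) (θ₀ A₀ B₀ η τ : ℝ)
    (a : α → Fin 2 → ℝ) (b : β → Fin 2 → ℝ)
    (hK : ∀ x y, 0 ≤ K x y) (hWK : ∀ x y, W x y ≤ K x y) (hθ : 0 ≤ θ₀) (hη : 0 < η) (hη1 : η ≤ 1)
    (hτ : 0 < τ) (hA : 0 < A₀) (hB : 0 < B₀)
    (ha : ∀ x, dotProduct (a x) (a x) ≤ A₀) (hb : ∀ y, dotProduct (b y) (b y) ≤ B₀)
    (hrect : ∀ (X : Finset α) (Y : Finset β), ∑ x ∈ X, ∑ y ∈ Y, W x y ≤ θ₀) :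
    ∑ x, ∑ y, W x y * (dotProduct (a x) (b y)) ^ 2 ≤
      (289 * π ^ 2) * (A₀ * B₀) ^ 2 / (η ^ 2 * τ) * θ₀
        + η * ∑ x, ∑ y, K x y * (dotProduct (a x) (b y)) ^ 2 + τ * ∑ x, ∑ y, K x y := by
  have key := netSandwich2_main K (fun x y => K x y - W x y) (fun _ _ => False) θ₀ A₀ B₀ η τ a b
    hK (fun x y => by linarith [hWK x y]) hθ hη hη1 hτ hA hB ha hb (fun _ _ h => h.elim)
    (fun X Y _ => by simpa only [sub_sub_cancel] using hrect X Y)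
  simpa only [sub_sub_cancel] using key

end Dominated

end Summit.PneNP.PneNP.Theorems.SmallBlockRothvoss

end
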